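import Mathlib
import Summits.CriticalPhenomena.PercolationContinuityZ3.Theorems.PercNearOneGluingNoHeavyLowerTailHurwitzPositivePairTN
import HarnessLib

/-!
# The Hurwitz matrix of an odd positive pair is totally nonnegative (Asner–Kemperman, odd degree)

Support file for the Sahi / Conjecture-P programme of route `PercNearOneGluingNoHeavy`
(`--supports stmt-CriticalPhenomena-4575`, prover prim-l12-p5 gen 49; proof note
`prim-l12-p5/PROOF-NEUTRAL-HURWITZ-LEAN-g49.md` §1).  No definitions, no named facts, no sorries.

`DiffHurwitz.positivePair_hurwitz_tn` (gen 48) treats pairs `(p, q)` with `deg p = deg q + 1` — the Hurwitz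
matrix of a stable polynomial of EVEN degree `p(z²) + z q(z²)`.  Here the companion case of EQUAL degrees
(stable polynomials of ODD degree): `P = lp·∏_{i<k}(X - α_i)`, `Q = lq·∏_{i<k}(X - γ_i)`, `lp, lq > 0`,
with negative strictly interlacing zeros in the order `γ_0 < α_0 < γ_1 < α_1 < … < γ_{k-1} < α_{k-1} < 0`
(the zero nearest `0` belongs to `P`, whose rows come first).  `DiffHurwitz.oddPair_hurwitz_tn`: the kernel
`H(2n, l) = [X^{n-l}] P`, `H(2n+1, l) = [X^{n-l}] Q` is totally nonnegative.  Proof: one Routh half-step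
`Q = Q₁ + (lq/lp)·P` with `(P, Q₁)` a positive pair in the sense of gen 48 (sign counting, IVT, Lagrange
uniqueness — the tools of `…FallingMesh`), so `H(P,Q)` is a down-step (`DiffHurwitz.tridiagStep_tn`) of the
totally nonnegative `H(P,Q₁)`.  This is the base matrix of THEOREM R^neut (`…NeutralHurwitzTN`).
-/

namespace Summit.CriticalPhenomena.PercolationContinuityZ3.Theorems

namespace DiffHurwitz

open Finset Polynomial FallingMesh

/-- **Routh half-step for an odd pair.**  If `P = lp·∏_{i≤k}(X - α_i)`, `Q = lq·∏_{i≤k}(X - γ_i)` with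
`lp, lq > 0` and `γ_0 < α_0 < γ_1 < … < γ_k < α_k`, then `Q = Q₁ + (lq/lp)·P` with
`Q₁ = lq₁·∏_{i<k}(X - γ'_i)`, `lq₁ > 0` and `α_i < γ'_i < α_{i+1}`. -/
theorem oddPair_reduce (k : ℕ) (lp lq : ℝ) (α γ : ℕ → ℝ) (hlp : 0 < lp) (hlq : 0 < lq)
    (hJ1 : ∀ i, i < k + 1 → γ i < α i) (hJ2 : ∀ i, i < k → α i < γ (i + 1)) :
    ∃ (lq₁ : ℝ) (γ' : ℕ → ℝ), 0 < lq₁ ∧ (∀ i, i < k → α i < γ' i ∧ γ' i < α (i + 1)) ∧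
      C lq * ∏ i ∈ range (k + 1), (X - C (γ i)) =
        C lq₁ * ∏ i ∈ range k, (X - C (γ' i)) + C (lq / lp) * (C lp * ∏ i ∈ range (k + 1), (X - C (α i))) := by
  have hαmono : ∀ i j, i < j → j < k + 1 → α i < α j := by
    intro i j hij hjk
    induction j with
    | zero => exact absurd hij (by omega)
    | succ j ihj =>
      rcases Nat.lt_or_ge i j with h' | h'
      · have := ihj h' (by omega); linarith [hJ2 j (by omega), hJ1 (j + 1) hjk]
      · rw [show i = j by omega]; linarith [hJ2 j (by omega), hJ1 (j + 1) hjk]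
  have hαle : ∀ i j, i ≤ j → j < k + 1 → α i ≤ α j := by
    intro i j hij hjk
    rcases Nat.lt_or_ge i j with h' | h'
    · exact (hαmono i j h' hjk).le
    · rw [show i = j by omega]
  have hγle : ∀ i j, i ≤ j → j < k + 1 → γ i ≤ γ j := by
    intro i j hij hjk
    rcases Nat.lt_or_ge i j with h' | h'
    · linarith [hJ1 i (by omega), hαle i (j - 1) (by omega) (by omega), hJ2 (j - 1) (by omega),
        show γ (j - 1 + 1) = γ j by rw [show j - 1 + 1 = j by omega]]
    · rw [show i = j by omega]
  obtain ⟨p, hp⟩ : ∃ p : ℝ[X], p = C lp * ∏ i ∈ range (k + 1), (X - C (α i)) := ⟨_, rfl⟩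
  obtain ⟨qq, hqq⟩ : ∃ qq : ℝ[X], qq = C lq * ∏ i ∈ range (k + 1), (X - C (γ i)) := ⟨_, rfl⟩
  obtain ⟨c, hc⟩ : ∃ c : ℝ, c = lq / lp := ⟨_, rfl⟩
  have hcpos : 0 < c := by rw [hc]; exact div_pos hlq hlp
  have hclp : c * lp = lq := by rw [hc]; field_simp
  obtain ⟨q₁, hq₁⟩ : ∃ q₁ : ℝ[X], q₁ = qq - C c * p := ⟨_, rfl⟩
  have hev₁ : ∀ y, q₁.eval y = lq * ∏ i ∈ range (k + 1), (y - γ i) - c * (lp * ∏ i ∈ range (k + 1), (y - α i)) := by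
    intro y; rw [hq₁, eval_sub, hqq, prodForm_eval, eval_mul, eval_C, hp, prodForm_eval]
  -- signs of q₁ at the zeros of p
  have hsg : ∀ j, j < k + 1 → 0 < (-1 : ℝ) ^ (k - j) * q₁.eval (α j) := by
    intro j hj
    have hz : ∏ i ∈ range (k + 1), (α j - α i) = 0 := prod_eq_zero (mem_range.2 hj) (sub_self _)
    have hs := sign_prod (k + 1) (k - j) γ (α j) (by omega)
      (fun i hi => by linarith [hJ1 i (by omega), hαle i j (by omega) hj])
      (fun i hi hi' => by
        have h1 := hJ2 j (by omega)
        linarith [hγle (j + 1) i (by omega) hi'])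
    rw [hev₁, hz]
    simp only [mul_zero, sub_zero]
    rw [show (-1 : ℝ) ^ (k - j) * (lq * ∏ i ∈ range (k + 1), (α j - γ i))
        = lq * ((-1 : ℝ) ^ (k - j) * ∏ i ∈ range (k + 1), (α j - γ i)) by ring]
    exact mul_pos hlq hs
  have hex : ∀ j, j < k → ∃ x, α j < x ∧ x < α (j + 1) ∧ q₁.eval x = 0 := by
    intro j hj
    apply exists_root_of_sign_change _ q₁.continuous _ _ (hαmono j (j + 1) (by omega) (by omega))
    have h1 := hsg j (by omega)
    have h2 := hsg (j + 1) (by omega)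
    rw [show (-1 : ℝ) ^ (k - j) = (-1) ^ (k - (j + 1)) * (-1) by
      rw [← pow_succ, show k - (j + 1) + 1 = k - j by omega]] at h1
    exact mul_neg_of_signs _ _ _ h1 h2
  choose! γ' hγ' using hex
  have hγ'1 : ∀ j, j < k → α j < γ' j := fun j hj => (hγ' j hj).1
  have hγ'2 : ∀ j, j < k → γ' j < α (j + 1) := fun j hj => (hγ' j hj).2.1
  have hγ'3 : ∀ j, j < k → q₁.eval (γ' j) = 0 := fun j hj => (hγ' j hj).2.2
  have hγ'mono : ∀ i j, i < j → j < k → γ' i < γ' j := by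
    intro i j hij hjk
    linarith [hγ'2 i (by omega), hγ'1 j hjk, hαle (i + 1) j (by omega) (by omega)]
  have hγ'top : ∀ j, j < k → γ' j < α k :=
    fun j hj => lt_of_lt_of_le (hγ'2 j hj) (hαle (j + 1) k (by omega) (by omega))
  -- degree and product form of q₁
  obtain ⟨hqnd, hqlc⟩ := prodForm_natDegree lq (ne_of_gt hlq) γ (k + 1)
  rw [← hqq] at hqnd hqlc
  obtain ⟨hGnd, hGlc⟩ := prodForm_natDegree (c * lp) (ne_of_gt (mul_pos hcpos hlp)) α (k + 1)
  have hGform : C c * p = C (c * lp) * ∏ i ∈ range (k + 1), (X - C (α i)) := by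
    rw [hp, ← mul_assoc, ← C_mul]
  rw [← hGform] at hGnd hGlc
  have hq₁deg : q₁.degree ≤ (k : ℕ) := by
    rw [hq₁]; exact degree_sub_le_of_cancel qq (C c * p) k hqnd hGnd (by rw [hqlc, hGlc, hclp])
  have hq₁form := eq_prod_of_roots k q₁ hq₁deg γ' hγ'mono hγ'3 (α k) hγ'top
  obtain ⟨lq₁, hlq₁⟩ : ∃ lq₁ : ℝ, lq₁ = q₁.eval (α k) / ∏ j ∈ range k, (α k - γ' j) := ⟨_, rfl⟩
  rw [← hlq₁] at hq₁form
  have hlq₁pos : 0 < lq₁ := by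
    rw [hlq₁]
    refine div_pos ?_ (prod_pos fun j hj => by rw [mem_range] at hj; linarith [hγ'top j hj])
    have := hsg k (by omega); rwa [Nat.sub_self, pow_zero, one_mul] at this
  refine ⟨lq₁, γ', hlq₁pos, fun i hi => ⟨hγ'1 i hi, hγ'2 i hi⟩, ?_⟩
  rw [← hq₁form, ← hc, ← hp, ← hqq, hq₁]; ring

/-- **Odd positive pairs have totally nonnegative Hurwitz matrices.**  For `P = lp·∏_{i<k}(X - α_i)`,
`Q = lq·∏_{i<k}(X - γ_i)` with `lp, lq > 0`, `γ_i < α_i < 0` (`i < k`) and `α_i < γ_{i+1}` (`i+1 < k`) — i.e.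
`γ_0 < α_0 < γ_1 < … < γ_{k-1} < α_{k-1} < 0` — the kernel `H(2n, l) = [X^{n-l}] P`, `H(2n+1, l) = [X^{n-l}] Q`
(zero for `l > n`) has all its minors `≥ 0`. -/
theorem oddPair_hurwitz_tn (k : ℕ) (lp lq : ℝ) (α γ : ℕ → ℝ) (hlp : 0 < lp) (hlq : 0 < lq)
    (hneg : ∀ i, i < k → α i < 0) (hJ1 : ∀ i, i < k → γ i < α i) (hJ2 : ∀ i, i + 1 < k → α i < γ (i + 1))
    {m : ℕ} (r s : Fin m → ℕ) (hr : StrictMono r) (hs : StrictMono s) :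
    0 ≤ (Matrix.of fun i j =>
      if r i % 2 = 0 then (if s j ≤ r i / 2 then (C lp * ∏ i ∈ range k, (X - C (α i))).coeff (r i / 2 - s j) else 0)
      else (if s j ≤ r i / 2 then (C lq * ∏ i ∈ range k, (X - C (γ i))).coeff (r i / 2 - s j) else 0)).det := by
  set P : ℝ[X] := C lp * ∏ i ∈ range k, (X - C (α i)) with hP
  set Q : ℝ[X] := C lq * ∏ i ∈ range k, (X - C (γ i)) with hQ
  -- the reduced second polynomial Q₁ with Q = Q₁ + (lq/lp)·P, and the TN of H(P, Q₁)
  obtain ⟨Q₁, hQdec, hTN₁⟩ : ∃ Q₁ : ℝ[X], Q = Q₁ + C (lq / lp) * P ∧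
      ∀ (m : ℕ) (r s : Fin m → ℕ), StrictMono r → StrictMono s →
        0 ≤ (Matrix.of fun i j =>
          if r i % 2 = 0 then (if s j ≤ r i / 2 then P.coeff (r i / 2 - s j) else 0)
          else (if s j ≤ r i / 2 then Q₁.coeff (r i / 2 - s j) else 0)).det := by
    rcases k with _ | k
    · -- constants: Q₁ = 0, H(P, 0) is the terminal kernel
      refine ⟨0, ?_, fun m r s hr hs => ?_⟩
      · rw [hQ, hP]
        simp only [prod_range_zero, mul_one, zero_add]
        rw [← C_mul, div_mul_cancel₀ _ (ne_of_gt hlp)]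
      · have heq : (Matrix.of fun i j =>
            if r i % 2 = 0 then (if s j ≤ r i / 2 then P.coeff (r i / 2 - s j) else 0)
            else (if s j ≤ r i / 2 then (0 : ℝ[X]).coeff (r i / 2 - s j) else 0)) =
            Matrix.of fun i j => if r i % 2 = 0 then (if s j = r i / 2 then lp else 0) else (0 : ℝ) := by
          ext i j
          simp only [Matrix.of_apply, hP, prod_range_zero, mul_one, coeff_zero, ite_self, coeff_C]
          by_cases h : r i % 2 = 0
          · rw [if_pos h, if_pos h]
            by_cases h1 : s j = r i / 2
            · rw [if_pos h1, if_pos (le_of_eq h1), h1, Nat.sub_self, if_pos rfl]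
            · rw [if_neg h1]
              by_cases h2 : s j ≤ r i / 2
              · rw [if_pos h2, if_neg (by omega)]
              · rw [if_neg h2]
          · rw [if_neg h, if_neg h]
        rw [heq]
        exact terminal_tn lp hlp.le r s hr hs
    · obtain ⟨lq₁, γ', hlq₁, hJ', hdec⟩ := oddPair_reduce k lp lq α γ hlp hlq
        (fun i hi => hJ1 i hi) (fun i hi => hJ2 i (by omega))
      refine ⟨C lq₁ * ∏ i ∈ range k, (X - C (γ' i)), by rw [hQ, hP, hdec], fun m r s hr hs => ?_⟩
      exact positivePair_hurwitz_tn k lp lq₁ α γ' hlp hlq₁ (hneg k (by omega)) hJ' r s hr hs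
  -- H(P, Q) is the down-step of H(P, Q₁) with the multiplier lq/lp on the odd rows
  set M : ℕ → ℕ → ℝ := fun t l =>
    if t % 2 = 0 then (if l ≤ t / 2 then P.coeff (t / 2 - l) else 0)
    else (if l ≤ t / 2 then Q₁.coeff (t / 2 - l) else 0) with hM
  have hc : 0 ≤ lq / lp := (div_pos hlq hlp).le
  have heq : (Matrix.of fun i j =>
      if r i % 2 = 0 then (if s j ≤ r i / 2 then P.coeff (r i / 2 - s j) else 0)
      else (if s j ≤ r i / 2 then Q.coeff (r i / 2 - s j) else 0)) =
      Matrix.of fun i j => M (r i) (s j) + (if r i % 2 = 0 then 0 else lq / lp) * M (r i - 1) (s j)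
        + (fun _ => (0 : ℝ)) (r i) * M (r i + 1) (s j) := by
    ext i j
    simp only [Matrix.of_apply, hM, zero_mul, add_zero]
    by_cases h : r i % 2 = 0
    · rw [if_pos h, if_pos h, if_pos h, zero_mul, add_zero]
    · have h1 : (r i - 1) % 2 = 0 := by omega
      have h2 : (r i - 1) / 2 = r i / 2 := by omega
      rw [if_neg h, if_neg h, if_neg h, if_pos h1, h2]
      by_cases hl : s j ≤ r i / 2
      · rw [if_pos hl, if_pos hl, if_pos hl, hQdec, coeff_add, coeff_C_mul]
      · rw [if_neg hl, if_neg hl, if_neg hl]; ring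
  rw [heq]
  refine tridiagStep_tn M (fun t => if t % 2 = 0 then 0 else lq / lp) (fun _ => 0)
    (fun t => by by_cases h : t % 2 = 0 <;> simp [h, hc]) (fun _ => le_rfl) (by norm_num) rfl
    (fun _ => mul_zero _) (fun m' r' s' hr' hs' => ?_) r s hr hs
  have := hTN₁ m' r' s' hr' hs'
  simpa only [hM] using this

end DiffHurwitz

end Summit.CriticalPhenomena.PercolationContinuityZ3.Theorems
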